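import Summits.KontsevichZagierPeriods.KontsevichZagierPeriods.Theses.CobordismMove
import Literature.NumberTheory.Transcendental.KZLogCalculusProofs
import Literature.NumberTheory.Transcendental.KZUnfoldedStokesProofs
import Literature.NumberTheory.Transcendental.KZGroundingRelations
import Literature.NumberTheory.Transcendental.BoxIntegralHurwitzWeightTwo

/-!
# `CubeCoordinateCycle` (stmt-KontsevichZagierPeriods-17772, route CobordismMove) — proof

CYCLING A COORDINATE TO THE LAST SLOT IS A MOVE, FOR AN ARBITRARY INTEGRAND ON THE OPEN UNIT CUBE
(piece P2 of the typed decomposition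
`CubeLastNewtonLeibniz → CubeCoordinateCycle → ZeroCombination → CubeStokes` of the route's crux
`CubeStokes`, stmt-KontsevichZagierPeriods-5566): for representations `R`, `R'` on the open cube
`(0,1)^(d+1)` with `R'.integrand z = R.integrand (Fin.insertNth k (z last) (Fin.init z))` on the cube,
`[R] − [R'] ∈ KZ.relations`.

Proof: ONE change-of-variables move (rule (2)) from `R'` to `R` along the linear coordinate
relabelling `Φ z = (i ↦ z (e i))`, `e = (finSuccEquiv' k).trans (finSuccEquiv' (Fin.last d)).symm`
(`exists_perm_insertNth`: `Φ z = insertNth k (z last) (init z)`), with `Φ' = Φ` as a continuous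
linear map: `Φ` is a `ℚ`-polynomial map (`isSemialgebraicMapOn_aeval` with the coordinates
`X (e i)`), injective, maps the open cube ONTO itself (`comp_perm_mem_setOf_iff`), and `|det Φ| = 1`
by volume preservation of the cube (`Measure.addHaar_image_continuousLinearMap`; the open
unit cube has volume `1`, the landed `BoxIntegral.volume_box`); then negate (`KZ.relations` is a
subgroup).

This is §2 of the crux strategist's complete sorry-free proof
`Summits/KontsevichZagierPeriods/KontsevichZagierPeriods/Cruxes/CubeStokes/CubeStokesProof.lean`
(seat planner-cstrat-stmt-KontsevichZagierPeriods-5566-r1-0, 2026-08-17), re-homed under `Theorems/`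
by lead c10 of crux stmt-KontsevichZagierPeriods-9129 (banking): the helper lemmas verbatim (the cube
volume lemma replaced by the landed `BoxIntegral.volume_box`), the literal body of the item as
`cubeCoordinateCycle_holds`, and the closing theorem
`cubeCoordinateCycle_proof : CubeCoordinateCycle`. No definitions are introduced.

References: M. Kontsevich, D. Zagier, *Periods* (2001), §1.2, rule (2); J. Bochnak, M. Coste,
M.-F. Roy, *Real Algebraic Geometry* (1998), §2.2.
-/

noncomputable section

open MeasureTheory Set MvPolynomial
open Literature.NumberTheory.Transcendental
open Literature.ModelTheory.ExponentialFields (IsSemialgebraic)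

namespace Summit.KontsevichZagierPeriods.CobordismMove

open Summit.KontsevichZagierPeriods.KontsevichZagierPeriods.Theses.CobordismMove

namespace CubeCoordinateCycle

variable {d : ℕ}

/-- The coordinate cycle `z ↦ Fin.insertNth k (z last) (Fin.init z)` of `ℝ^(d+1)` is the
relabelling of coordinates along the index permutation
`(finSuccEquiv' k).trans (finSuccEquiv' (Fin.last d)).symm` (`k ↦ last`, `k.succAbove j ↦ j.castSucc`).
[folklore] -/
theorem exists_perm_insertNth (k : Fin (d + 1)) :
    ∃ e : Equiv.Perm (Fin (d + 1)), ∀ z : Fin (d + 1) → ℝ,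
      (fun i => z (e i)) = (Fin.insertNth k (z (Fin.last d)) (Fin.init z) : Fin (d + 1) → ℝ) := by
  refine ⟨(finSuccEquiv' k).trans (finSuccEquiv' (Fin.last d)).symm, fun z => ?_⟩
  funext i
  rcases Fin.eq_self_or_eq_succAbove k i with rfl | ⟨j, rfl⟩
  · simp [finSuccEquiv'_at, finSuccEquiv'_symm_none, Fin.insertNth_apply_same]
  · simp [finSuccEquiv'_succAbove, finSuccEquiv'_symm_some, Fin.insertNth_apply_succAbove,
      Fin.succAbove_last, Fin.init]

/-- The open unit cube is invariant under relabelling coordinates. [folklore] -/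
theorem comp_perm_mem_setOf_iff {n : ℕ} (e : Equiv.Perm (Fin n)) (z : Fin n → ℝ) :
    (fun i => z (e i)) ∈ {x : Fin n → ℝ | ∀ i, x i ∈ Ioo (0 : ℝ) 1} ↔
      z ∈ {x : Fin n → ℝ | ∀ i, x i ∈ Ioo (0 : ℝ) 1} := by
  simp only [mem_setOf_eq]
  exact ⟨fun h i => by simpa using h (e.symm i), fun h i => h (e i)⟩

/-- **`CubeCoordinateCycle`, literal body** (stmt-KontsevichZagierPeriods-17772): cycling a
coordinate of the open unit cube to the last slot is a move, for an arbitrary integrand.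
[cite: KontsevichZagier2001, §1.2 rule (2)] -/
theorem cubeCoordinateCycle_holds :
    ∀ (d : ℕ) (k : Fin (d + 1)) (R R' : Literature.NumberTheory.Transcendental.KZ.IntegralRep (d + 1)),
      R.domain = {x : Fin (d + 1) → ℝ | ∀ i, x i ∈ Set.Ioo (0 : ℝ) 1} →
      R'.domain = {x : Fin (d + 1) → ℝ | ∀ i, x i ∈ Set.Ioo (0 : ℝ) 1} →
      Set.EqOn R'.integrand (fun z => R.integrand (Fin.insertNth k (z (Fin.last d)) (Fin.init z))) R'.domain →
      Literature.NumberTheory.Transcendental.KZ.of R - Literature.NumberTheory.Transcendental.KZ.of R' ∈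
        Literature.NumberTheory.Transcendental.KZ.relations := by
  intro d k R R' hRd hR'd hR'i
  obtain ⟨e, he⟩ := exists_perm_insertNth (d := d) k
  -- the relabelling as a continuous linear map
  set L : (Fin (d + 1) → ℝ) →L[ℝ] (Fin (d + 1) → ℝ) :=
    LinearMap.toContinuousLinearMap (LinearMap.funLeft ℝ ℝ e) with hL
  have hLapply : ∀ x : Fin (d + 1) → ℝ, L x = fun i => x (e i) := fun x => by
    rw [hL, LinearMap.coe_toContinuousLinearMap']
    rfl
  -- `L` maps the cube onto itself, injectively
  have himage : L '' R'.domain = R.domain := by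
    rw [hRd, hR'd]
    ext y
    constructor
    · rintro ⟨x, hx, rfl⟩
      rw [hLapply]
      exact (comp_perm_mem_setOf_iff e x).2 hx
    · intro hy
      refine ⟨fun i => y (e.symm i), ?_, ?_⟩
      · have h := (comp_perm_mem_setOf_iff e.symm y).2 hy
        exact h
      · rw [hLapply]
        funext i
        simp
  have hLinj : InjOn L R'.domain := by
    intro x _ y _ hxy
    rw [hLapply, hLapply] at hxy
    funext j
    have h := congr_fun hxy (e.symm j)
    simpa using h
  -- `L` is a `ℚ`-polynomial (coordinate) map, hence semialgebraic
  have hLsa : IsSemialgebraicMapOn ℚ R'.domain L := by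
    refine (isSemialgebraicMapOn_aeval R'.isSemialgebraic_domain fun j => X (e j)).congr fun x _ => ?_
    rw [hLapply]
    ext j
    simp
  -- `|det L| = 1` by volume preservation of the cube
  have hdet : |L.det| = 1 := by
    have h := Measure.addHaar_image_continuousLinearMap volume L R'.domain
    rw [himage, hRd, BoxIntegral.volume_box, hR'd, BoxIntegral.volume_box, mul_one] at h
    exact ENNReal.ofReal_eq_one.1 h.symm
  -- one change-of-variables move from `R'` to `R`
  have hcov : KZ.of R' - KZ.of R ∈ KZ.changeOfVariablesRel := by
    refine ⟨d + 1, R', R, L, fun _ => L, hLsa, fun _ _ => L.hasFDerivWithinAt, hLinj, himage.symm,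
      fun x hx => ?_, rfl⟩
    rw [hR'i hx, hdet, mul_one, hLapply, he x]
  have h := KZ.changeOfVariablesRel_subset_relations hcov
  have hneg : KZ.of R - KZ.of R' = -(KZ.of R' - KZ.of R) := by abel
  rw [hneg]
  exact KZ.relations.neg_mem h

/-- **Settles stmt-KontsevichZagierPeriods-17772 (`CubeCoordinateCycle`)**: the route declaration
`Summit.KontsevichZagierPeriods.KontsevichZagierPeriods.Theses.CobordismMove.CubeCoordinateCycle`,
concluded by name from its literal body `cubeCoordinateCycle_holds`.
[cite: KontsevichZagier2001, §1.2 rule (2)] -/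
theorem cubeCoordinateCycle_proof : CubeCoordinateCycle :=
  cubeCoordinateCycle_holds

end CubeCoordinateCycle

end Summit.KontsevichZagierPeriods.CobordismMove
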